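/-
Copyright (c) 2026 the pub-hodgecm-mathlib formalisation cell (harness21).  Prover seat hodgecm-mathlib-LH7-p08 (g0) (re-dealt to strike line L3 `stub_N6nsDyadic` by director
s1969 (a)), Track A «(D-RAM) FOUR-FRAME» squad, helper lane on h413 = stmt-HodgeConjecture-24833 (count-neutral).  β-BOARD v1 row R8 ∕ (P5) «H `(2ρ,2ρ,2ρ)`», FILE 4c: the
labelled-odd TABLE VALUE of the core-hanging stratum for the BOUNDARY key `(m, m, L)`, `L − m = 2d − 2`: `(0, 0, −ω(−1)(ω e_A + ω e_B))∕2 · q^{2ρ−1}` = «−S».  2026-09-04.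
-/
import Summits.HodgeConjecture.HodgeConjecture.Theorems.F0P3cDyRamLabelledOddCoreHangingBoundaryOrbit   -- (this seat, FILE 4c′): `v_towerSign_sub_eq_of_sub_boundary`, `finsum_orbit_labelledOdd_div_relIndex_eq_of_near₃`; brings ★ FILE 4a, ★ FILE 3b's imports (★ FILE 1, ★ κH-B2, ★ tokens, ★ parity)
import Summits.HodgeConjecture.HodgeConjecture.Theorems.F0P3cDyRamAdmissibleShiftedCharacterSums       -- (this seat, FILE 4b): `sum_normSign_add_eq_zero`, `sum_normSign_mul_normSign_add_eq_zero`
import Summits.HodgeConjecture.HodgeConjecture.Theorems.F0P3cDyRamAdmissibleAdditiveCharacterSum       -- (this seat, FILE 4b′): `normSign_one_add_mul_add`, `sum_normSign_one_add_mul_eq_of_repr_admissible`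
import HarnessLib

/-!
# Crux `H413`, line LH4 «(D-RAM) FOUR-FRAME» — (β) table, β-BOARD row R8 ∕ (P5), FILE 4c: «THE H ROW FOR THE BOUNDARY KEY `(m, m, L)`, `L − m = 2d − 2`» —
# `Σᶠ_{M ∈ H(ρ), clean shell} m^Λ_i(M)∕[𝒰 : N S̃(M)] = (0, 0, −ω(−1)·(ω(e_A) + ω(e_B)))_i ∕ 2 · q^{2ρ−1}` at `2ρ + ℓ₀ = m` (general `q`; `= −S` of the H-ROW DERIVATION)

Cell `hodgecm-mathlib` (D-0151), FLOOR 0, crux item H413 = `stmt-HodgeConjecture-24833`, route `HCCMUnconditional`; squad F0∕P3c∕LH4.  THEOREMS ONLY (no `def`, no instance, no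
notation, no `sorry`, default heartbeats); ★-only imports; lane `--supports stmt-HodgeConjecture-24833 --as helper` (count-neutral); pays NO row, states NO law.

THE MATHEMATICS (this seat's H-ROW DERIVATION v1 e4da7f0103cc4a29 §3∕§4, key `(m, m, L)`, the BOUNDARY `s_g = L − m = 2d − 2`: the term `−2·[s_g = 2d−2]` of §4, i.e. `H = −S`).
At the boundary the two depth-`m` tokens satisfy `|e_B − e_A| = |ϖ|^{2d−2}` EXACTLY (§0: the ★ token identity with `|β − α| = |ϖ|^{m+2d−2}` now DOMINATING), so with `g_α = π₀^ρ e_A`,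
`g_β = π₀^ρ e_B`, `c = e_B∕e_A = 1 + δ`, `|δ| = |ϖ|^{2d−2}`: FILE 4a's weak letters hold (`|ϖ|^ρ·|g_β − g_α| ≤ |ϖ|^{2d−1}|g·g_α + g_β|` as `ρ ≥ 1`), the label is ONE-SLOT in slot 2 with
`ε(g) = ω(g·g_α + g_β) = ω(e_A)·ω(g + c)`, and the per-lattice value on the orbit of `V_H(1,1,g)` is `w∕2·(ω(g)ι, ι, ω(−(1+g)))·ε(g)` (§1).  Summing over the admissible classes
`g ∈ R`, `|1+g| = 1` (★ B7 (iv) (C), ★ (iv-c), orbit mass `q^{2ρ−1}∕q^{⌈ρ∕2⌉−1}`):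
* slots 0, 1 (alive window `ι = 1`): `ω(e_A)·Σ_g ω(g)ω(g + c) = 0`, `ω(e_A)·Σ_g ω(g + c) = 0` — FILE 4b's shifted sums (dead window: `ι = 0`);
* slot 2: `ω(−(1+g))·ε(g) = ω(−1)ω(e_A)·ω(1+g)ω(g+c)` and `ω(1+g)ω(g+c) = ω(1 + δ(1+h)) = ω(1+δ)·ω(1 + δh)`, `h = −g∕(1+g)` (`(1+g)(g+c) = (1+g)²(1 + δ∕(1+g))`, `1∕(1+g) = 1 + h`,
  FILE 4b′ additivity); `h` runs over the ★ Möbius-transported admissible system, so FILE 4b′ §3 gives `Σ_g = ω(1+δ)·(−q^{⌈ρ∕2⌉−1})(1 + ω(1−δ))`, and `ω(1−δ) = ω(1+δ) = ω(e_A)ω(e_B)`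
  (`2δ ∈ 𝔭^{2d}`): the slot-2 total is `−ω(−1)(ω(e_A) + ω(e_B))∕2 · q^{2ρ−1}` — MINUS `S = (σ₁[2] + σ₂[2])∕2·q^{m−ℓ₀−1}` of the derivation (`σ₁[2] = ω(−1)ω(e_B)`, `σ₂[2] = ω(−1)ω(e_A)`).
* HEAD `finsum_stratum_H_shell_labelledOdd_div_relIndex_eq_of_boundary₃` (★ p860780∕p860897 finsum letters VERBATIM with the H axis; twin of ★ p861620's deep head with `hbdry : n₃ + 2 = n₁ + 2d`
  for `hdeep`); the letter `|e_A − e_B| = |ϖ|^{2d−2}` and the orbit sum are FILE 4c′ (`…BoundaryOrbit`).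
HONEST LABEL.  Count-neutral (`--supports`); the boundary keys `(m,L,m)`∕`(L,m,m)`, the shallow keys, the equilateral key, `hRest`, (T3), (β-BAL), (β), T₊ stay OPEN; `HC_CM` is proved
only modulo the 7 printed citations (2 remaining named inputs: hLiu418 = `stmt-HodgeConjecture-24832`, h413 = `stmt-HodgeConjecture-24833`) until rung 0 closes.

## References
* [Kottwitz1986BaseChangeUnits] R. E. Kottwitz, *Base change for unit elements of Hecke algebras*, Compositio Math. 60 (1986), §1 pp. 240–241 (signed lattice counts modulo the torus).
* [LanglandsShelstad1987] R. P. Langlands, D. Shelstad, *On the definition of transfer factors*, Math. Ann. 278 (1987), §3.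
* [Rogawski1990] J. D. Rogawski, *Automorphic Representations of Unitary Groups in Three Variables*, Ann. of Math. Stud. 123 (1990), §4.9 Prop. 4.9.1 (a)(b) p. 55, §4.10 p. 58.
* [Serre1979] J.-P. Serre, *Local Fields*, GTM 67 (1979), Ch. V §3 Cor. 3, Ch. XV §2 (the conductor; the break `U^{(d−1)}∕U^{(d)}`).
-/

set_option autoImplicit false

noncomputable section

namespace Summit.HodgeConjecture.HodgeConjecture.Cruxes.H413.F0P3cDyRamLabelledOddCoreHangingBoundarySum

open Matrix WithZero
open Literature.NumberTheory.Automorphic Literature.NumberTheory.Automorphic.HermitianLattice Literature.NumberTheory.Automorphic.UnitaryGroup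
open Literature.NumberTheory.Automorphic.UnitaryLatticeTree Literature.NumberTheory.Automorphic.UnitaryThreeFourFrame
open Literature.NumberTheory.LocalFields Literature.NumberTheory.LocalFields.WildQuadraticDatum
open Summit.HodgeConjecture.HodgeConjecture.Cruxes.H413.F0P3cDyRamFourFramePieces
open Summit.HodgeConjecture.HodgeConjecture.Cruxes.H413.F0P3cDyRamFourFrameCensusDefs
open Summit.HodgeConjecture.HodgeConjecture.Cruxes.H413.F0P3cDyRamStageOneBDefs
open Summit.HodgeConjecture.HodgeConjecture.Cruxes.H413.F0P3cDyRamDiagonalTorusDefs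
open Summit.HodgeConjecture.HodgeConjecture.Cruxes.H413.F0P3cDyRamDiagonalStrataDefs
open Summit.HodgeConjecture.HodgeConjecture.Cruxes.H413.F0P3cDyRamLabelledOddCountDefs
open Summit.HodgeConjecture.HodgeConjecture.Cruxes.H413.F0P3cDyRamLabelledOddCoreHangingBoundaryOrbit (v_towerSign_sub_eq_of_sub_boundary finsum_orbit_labelledOdd_div_relIndex_eq_of_near₃)
open Summit.HodgeConjecture.HodgeConjecture.Cruxes.H413.F0P3cDyRamAdmissibleShiftedCharacterSums (sum_normSign_add_eq_zero sum_normSign_mul_normSign_add_eq_zero)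
open Summit.HodgeConjecture.HodgeConjecture.Cruxes.H413.F0P3cDyRamAdmissibleAdditiveCharacterSum (normSign_one_add_mul_add sum_normSign_one_add_mul_eq_of_repr_admissible)
open Summit.HodgeConjecture.HodgeConjecture.Cruxes.H413.F0P3cDyRamDiagonalKappaCoreHangingCharacterMaps (repr_admissible_image_moebius one_add_moebius moebius_moebius v_moebius v_add_eq_one_of_lt)
open Summit.HodgeConjecture.HodgeConjecture.Cruxes.H413.F0P3cDyRamLabelledOddCoreHangingShell (shell_iff_of_mem_stratum_H finsum_stratum_H_shell_eq_of_eq)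
open Summit.HodgeConjecture.HodgeConjecture.Cruxes.H413.F0P3cDyRamDiagonalCoreHangingSocket (stratum_H_eq)
open Summit.HodgeConjecture.HodgeConjecture.Cruxes.H413.F0P3cDyRamDiagonalCoreHangingCount (coreHangingStratum_eq_iUnion_orbits pairwise_disjoint_orbits finsum_stabiliserWeight_orbit_eq)
open Summit.HodgeConjecture.HodgeConjecture.Cruxes.H413.F0P3cDyRamDiagonalCoreHangingOrbits (exists_coreHanging_of_mem_orbit)
open Summit.HodgeConjecture.HodgeConjecture.Cruxes.H413.F0P3cDyRamDiagonalCoreHangingClasses (ncard_admissible_representatives_eq)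
open Summit.HodgeConjecture.HodgeConjecture.Cruxes.H413.F0P3cDyRamDiagonalGluedTorusOrbits (exists_gl_coe_eq_glued)
open Summit.HodgeConjecture.HodgeConjecture.Cruxes.H413.F0P3cDyRamDiagonalGluedClassRepresentatives (exists_fixed_class_representatives)
open Summit.HodgeConjecture.HodgeConjecture.Cruxes.H413.F0P3cDyRamDiagonalGluedStabiliserIndex (ne_zero_and_v_lt_one_of_v_eq_exp)
open Summit.HodgeConjecture.HodgeConjecture.Cruxes.H413.F0P3cDyRamDiagonalKappaCoreHangingSocket (finite_orbit)
open Summit.HodgeConjecture.HodgeConjecture.Cruxes.H413.F0P3cDyRamDiagonalCoreHangingPolarisationExplicit (normSign_mul_norm')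
open Summit.HodgeConjecture.HodgeConjecture.Cruxes.H413.F0P3cDyRamStableCountTypeZero (v_diag_eq_one)
open Summit.HodgeConjecture.HodgeConjecture.Cruxes.H413.F0P3cDyRamDiagonalStratumTools (finsum_mem_eq_ncard_mul)
open Summit.HodgeConjecture.HodgeConjecture.Cruxes.H413.F0P3cDyRamDiagonalKappaCoreHangingClass (two_le_d_of_v_two_lt_one)
open scoped Valued WithZero Matrix MatrixGroups

variable {K : Type} [Field K] [Valued K ℤᵐ⁰]

/-! ## HEAD — the H row for the boundary key `(m, m, L)`, `L − m = 2d − 2` -/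

/-- **THE H ROW, BOUNDARY KEY `(m, m, L)` (`n₁ = n₂ = m`, `n₃ = m + 2d − 2`), AT `2ρ + ℓ₀ = m`.**  Ramified datum on a complete field with finite residue field `q = #𝓀`, `|2| < 1`; element
datum with `mcOfRecord d ≤ N₀`; `T = diag(α, β, 1)`; tower-sign tokens `e_A` of `α − 1` (depth `n₂`) and `e_B` of `β − 1` (depth `n₁`) — ★ p860780's `heA`∕`heB` VERBATIM.  Then for every slot
`i`:  `Σᶠ_{M ∈ stratum σ ϖ T (2ρ,2ρ,2ρ), clean shell} labelledOddCount σ ϖ 0 i Λ M ∕ [𝒰 : N(S̃′(M))] = (0, 0, −ω(−1)·(ω(e_A) + ω(e_B)))_i ∕ 2 · q^{2ρ−1}`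
(`Λ = valueClassLabel σ ϖ (α−1) (β−1) m* d`): the special slot `2` carries MINUS `S = (σ₁[2]+σ₂[2])∕2·q^{m−ℓ₀−1}` of the H-ROW DERIVATION (`σ₁[2] = ω(−1)ω(e_B)`, `σ₂[2] = ω(−1)ω(e_A)` —
at the boundary the two signs are NOT related), the other two slots vanish (FILE 4b's shifted sums in the alive window, the dead indicator otherwise).
[cite: Kottwitz1986BaseChangeUnits, §1 pp. 240–241] [cite: LanglandsShelstad1987, §3] [cite: Rogawski1990, §4.9 Prop. 4.9.1 (a)(b) p. 55, §4.10 p. 58] [cite: Serre1979, Ch. XV §2] -/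
theorem finsum_stratum_H_shell_labelledOdd_div_relIndex_eq_of_boundary₃ [CompleteSpace K] [Finite 𝓀[K]] {σ : K →+* K} {ϖ : K} {d t : ℕ}
    (hD : IsRamifiedQuadraticDatum σ ϖ d t) (h2 : Valued.v (2 : K) < 1)
    {α β : K} {N₀ n₁ n₂ n₃ : ℕ} (hE : IsElementDatum σ ϖ N₀ α β n₁ n₂ n₃) (hmc : mcOfRecord d ≤ N₀) (h12 : n₁ = n₂) (hbdry : n₃ + 2 = n₁ + 2 * d)
    (T : GL (Fin 3) K) (hT : (T : Matrix (Fin 3) (Fin 3) K) = Matrix.diagonal ![α, β, 1]) (ρ : ℕ) (hρ : 1 ≤ ρ) (h2ρ : 2 * ρ + d % 2 = n₁)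
    {eA eB : K} (hσeA : σ eA = eA) (heA1 : Valued.v eA = 1) (hσeB : σ eB = eB)
    (heA : Valued.v ((ϖ ^ mstarOfRecord d)⁻¹ * ((α - 1) * ((ϖ * σ ϖ) ^ ((n₂ - d % 2) / 2))⁻¹ - eA * ((ϖ - σ ϖ) * ((ϖ * σ ϖ) ^ ((d - d % 2) / 2))⁻¹))) ≤ 1)
    (heB : Valued.v ((ϖ ^ mstarOfRecord d)⁻¹ * ((β - 1) * ((ϖ * σ ϖ) ^ ((n₁ - d % 2) / 2))⁻¹ - eB * ((ϖ - σ ϖ) * ((ϖ * σ ϖ) ^ ((d - d % 2) / 2))⁻¹))) ≤ 1)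
    (i : Fin 3) :
    ∑ᶠ M ∈ {M : Submodule 𝒪[K] (Fin 3 → K) | M ∈ stratum σ ϖ T ![2 * ρ, 2 * ρ, 2 * ρ] ∧
        (LatticeInLevel ϖ (d % 2) (Matrix.diagonal ![α - 1, β - 1, 0]) M ∧ ¬ LatticeInLevel ϖ (d % 2 + 1) (Matrix.diagonal ![α - 1, β - 1, 0]) M ∧
          LatticeInLevel ϖ (mcOfRecord d) (Matrix.diagonal ![(α - 1) * (α - 1), (β - 1) * (β - 1), 0]) M)},
      (labelledOddCount σ ϖ 0 i (valueClassLabel σ ϖ (α - 1) (β - 1) (mstarOfRecord d) d) M : ℚ) /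
        ((((unitStabilizer M).map (unitNormMap σ 3)).relIndex (fixedUnitTorus σ 3) : ℕ) : ℚ) =
      (((![0, 0, -(normSign σ (-1 : K) * (normSign σ eA + normSign σ eB))] : Fin 3 → ℤ) i : ℤ) : ℚ) / 2 * (Nat.card 𝓀[K] : ℚ) ^ (2 * ρ - 1) := by
  classical
  have hTr := trace_bound_of_isRamifiedQuadraticDatum hD h2
  have hiso := F0P3cDyRamElementDatumParity.isoceles_of_isElementDatum hD hE
  obtain ⟨hσ, hvσ, hϖ, hfix, hd, hd1, -⟩ := id hD
  obtain ⟨hϖ0, hϖ1⟩ := ne_zero_and_v_lt_one_of_v_eq_exp hϖ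
  have hvϖ0 : Valued.v ϖ ≠ 0 := (Valuation.ne_zero_iff _).2 hϖ0
  have hq : 1 < Nat.card 𝓀[K] := Finite.one_lt_card
  have h2d : 2 ≤ d := two_le_d_of_v_two_lt_one hD h2
  have hσϖ0 : σ ϖ ≠ 0 := (map_ne_zero σ).2 hϖ0
  have hπ0 : ((ϖ * σ ϖ) ^ ρ : K) ≠ 0 := pow_ne_zero _ (mul_ne_zero hϖ0 hσϖ0)
  have hvπ : 0 < Valued.v ((ϖ * σ ϖ) ^ ρ) := (Valuation.pos_iff _).2 hπ0
  have hpρ : Valued.v ϖ ^ ρ < 1 := pow_lt_one₀ zero_le hϖ1 (by omega)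
  -- element letters
  have hα1 : Valued.v α = 1 := (v_diag_eq_one hvσ hE) 0
  have hβ1 : Valued.v β = 1 := (v_diag_eq_one hvσ hE) 1
  have h₁ : Valued.v (β - 1) = Valued.v ϖ ^ n₁ := hE.2.2.2.2.2.1
  have h₂ : Valued.v (α - 1) = Valued.v ϖ ^ n₂ := hE.2.2.2.2.2.2.1
  have h₃ : Valued.v (β - α) = Valued.v ϖ ^ n₃ := by rw [Valuation.map_sub_swap]; exact hE.2.2.2.2.2.2.2.1
  have hn₁ : N₀ ≤ n₁ := hE.2.2.2.2.2.2.2.2.1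
  -- numerics of the letters
  have hmcv : mcOfRecord d = 2 * ((d % 2 + 2 * d - 1 + d) / 2) := rfl
  have hmsv : mstarOfRecord d = d % 2 + 2 * d - 1 := rfl
  have hℓN : d % 2 + 1 ≤ N₀ := by rw [hmcv] at hmc; omega
  have hmN : d % 2 + 2 * d - 1 ≤ N₀ := by rw [hmcv] at hmc; omega
  have hℓmc : 2 * (d % 2) + 1 ≤ mcOfRecord d := by rw [hmcv]; omega
  have hmmc : d % 2 + 2 * d - 1 + d % 2 ≤ mcOfRecord d := by rw [hmcv]; omega
  have hneq : ¬ (n₁ = n₂ ∧ n₂ = n₃) := fun h => by omega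
  have h2ρmin : 2 * ρ + d % 2 = min n₁ n₂ := by omega
  have h2ρ' : 2 * d - 1 ≤ 2 * ρ := by omega
  have hρ₁ : 2 * ρ ≤ n₁ := by omega
  have hρ₂ : 2 * ρ ≤ n₂ := by omega
  have hρ₃ : ρ ≤ n₃ := by omega
  have hkα : (n₂ - d % 2) / 2 = ρ := by omega
  have hkβ : (n₁ - d % 2) / 2 = ρ := by omega
  -- §0: the EXACT boundary letter `|e_A − e_B| = |ϖ|^{2d−2}`
  have hpar : n₂ % 2 = d % 2 := by omega
  have heB' : Valued.v ((ϖ ^ mstarOfRecord d)⁻¹ * ((β - 1) * ((ϖ * σ ϖ) ^ ((n₂ - d % 2) / 2))⁻¹ - eB * ((ϖ - σ ϖ) * ((ϖ * σ ϖ) ^ ((d - d % 2) / 2))⁻¹))) ≤ 1 := by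
    rw [← h12]; exact heB
  have hδE : Valued.v (eA - eB) = Valued.v ϖ ^ (2 * d - 2) :=
    v_towerSign_sub_eq_of_sub_boundary hD (L := n₃) h₃ (by omega) (by omega) hpar heA heB'
  rw [hkα] at heA
  rw [hkβ] at heB
  -- `e_B` is a unit, `c := e_B ∕ e_A` has `|c − 1| < 1`, `δ := c − 1` has `|δ| = |ϖ|^{2d−2}`
  have heA0 : eA ≠ 0 := fun h => by rw [h, map_zero] at heA1; exact zero_ne_one heA1
  have hδ1 : Valued.v ϖ ^ (2 * d - 2) < 1 := pow_lt_one₀ zero_le hϖ1 (by omega)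
  have heB1 : Valued.v eB = 1 := by
    rw [show eB = eA + -(eA - eB) by ring]; exact v_add_eq_one_of_lt heA1 (by rw [Valuation.map_neg, hδE]; exact hδ1)
  have heB0 : eB ≠ 0 := fun h => by rw [h, map_zero] at heB1; exact zero_ne_one heB1
  have hσc : σ (eB / eA) = eB / eA := by rw [map_div₀, hσeA, hσeB]
  have hvδ : Valued.v (eB / eA - 1) = Valued.v ϖ ^ (2 * d - 2) := by
    rw [div_sub_one heA0, map_div₀, heA1, div_one, Valuation.map_sub_swap, hδE]
  have hc1 : Valued.v (eB / eA - 1) < 1 := by rw [hvδ]; exact hδ1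
  have hσδ : σ (eB / eA - 1) = eB / eA - 1 := by rw [map_sub, map_one, hσc]
  -- the approximants `g_α = π₀^ρ e_A`, `g_β = π₀^ρ e_B` and their letters
  have hσπ : σ ((ϖ * σ ϖ) ^ ρ) = (ϖ * σ ϖ) ^ ρ := by rw [map_pow, map_mul, hσ, mul_comm]
  have hσgα : σ ((ϖ * σ ϖ) ^ ρ * eA) = (ϖ * σ ϖ) ^ ρ * eA := by rw [map_mul, hσπ, hσeA]
  have hσgβ : σ ((ϖ * σ ϖ) ^ ρ * eB) = (ϖ * σ ϖ) ^ ρ * eB := by rw [map_mul, hσπ, hσeB]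
  have hrew : ∀ x e : K, ((ϖ * σ ϖ) ^ ρ)⁻¹ * (x - (ϖ * σ ϖ) ^ ρ * e * ((ϖ - σ ϖ) * ((ϖ * σ ϖ) ^ ((d - d % 2) / 2))⁻¹)) =
      x * ((ϖ * σ ϖ) ^ ρ)⁻¹ - e * ((ϖ - σ ϖ) * ((ϖ * σ ϖ) ^ ((d - d % 2) / 2))⁻¹) := fun x e => by field_simp
  have hgα : Valued.v ((ϖ ^ (d % 2 + 2 * d - 1))⁻¹ * (((ϖ * σ ϖ) ^ ρ)⁻¹ * ((α - 1) - (ϖ * σ ϖ) ^ ρ * eA * ((ϖ - σ ϖ) * ((ϖ * σ ϖ) ^ ((d - d % 2) / 2))⁻¹)))) ≤ 1 := by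
    rw [hrew, ← hmsv]; exact heA
  have hgβ : Valued.v ((ϖ ^ (d % 2 + 2 * d - 1))⁻¹ * (((ϖ * σ ϖ) ^ ρ)⁻¹ * ((β - 1) - (ϖ * σ ϖ) ^ ρ * eB * ((ϖ - σ ϖ) * ((ϖ * σ ϖ) ^ ((d - d % 2) / 2))⁻¹)))) ≤ 1 := by
    rw [hrew, ← hmsv]; exact heB
  -- FILE 4a's weak letters for every admissible `g`, and `ε(g) = ω(e_A)·ω(g + c)`
  have hG : ∀ g : K, σ g = g → Valued.v g = 1 → Valued.v (1 + g) = 1 →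
      g * ((ϖ * σ ϖ) ^ ρ * eA) + (ϖ * σ ϖ) ^ ρ * eB ≠ 0 ∧
      Valued.v ϖ ^ (2 * ρ) * Valued.v ((ϖ * σ ϖ) ^ ρ * eA) ≤ Valued.v ϖ ^ (2 * d - 1) * Valued.v (g * ((ϖ * σ ϖ) ^ ρ * eA) + (ϖ * σ ϖ) ^ ρ * eB) ∧
      Valued.v ϖ ^ ρ * Valued.v ((ϖ * σ ϖ) ^ ρ * eB - (ϖ * σ ϖ) ^ ρ * eA) ≤ Valued.v ϖ ^ (2 * d - 1) * Valued.v (g * ((ϖ * σ ϖ) ^ ρ * eA) + (ϖ * σ ϖ) ^ ρ * eB) ∧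
      normSign σ (g * ((ϖ * σ ϖ) ^ ρ * eA) + (ϖ * σ ϖ) ^ ρ * eB) = normSign σ eA * normSign σ (g + eB / eA) := by
    intro g hσg hvg h1g
    obtain ⟨hgc, -⟩ := F0P3cDyRamAdmissibleShiftedCharacterSums.v_add_admissible h2 hvg h1g hc1
    have hgc0 : g + eB / eA ≠ 0 := fun h => by rw [h, map_zero] at hgc; exact zero_ne_one hgc
    have hfacG : g * ((ϖ * σ ϖ) ^ ρ * eA) + (ϖ * σ ϖ) ^ ρ * eB = (ϖ * σ ϖ) ^ ρ * (eA * (g + eB / eA)) := by field_simp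
    have hvG : Valued.v (g * ((ϖ * σ ϖ) ^ ρ * eA) + (ϖ * σ ϖ) ^ ρ * eB) = Valued.v ((ϖ * σ ϖ) ^ ρ) := by
      rw [hfacG, map_mul, map_mul, heA1, hgc, mul_one, mul_one]
    have hvgα : Valued.v ((ϖ * σ ϖ) ^ ρ * eA) = Valued.v ((ϖ * σ ϖ) ^ ρ) := by rw [map_mul, heA1, mul_one]
    refine ⟨fun h => by rw [h, map_zero] at hvG; exact hvπ.ne hvG, ?_, ?_, ?_⟩
    · rw [hvgα, hvG]
      exact mul_le_mul' (pow_le_pow_right_of_le_one' hϖ1.le h2ρ') le_rfl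
    · rw [hvG, ← mul_sub, map_mul, Valuation.map_sub_swap, hδE, mul_comm (Valued.v ((ϖ * σ ϖ) ^ ρ)), ← mul_assoc, ← pow_add]
      exact mul_le_mul' (pow_le_pow_right_of_le_one' hϖ1.le (by omega)) le_rfl
    · rw [hfacG, show (ϖ * σ ϖ) ^ ρ * (eA * (g + eB / eA)) = ϖ ^ ρ * σ (ϖ ^ ρ) * (eA * (g + eB / eA)) by rw [map_pow, ← mul_pow],
        normSign_mul_norm' σ _ (pow_ne_zero _ hϖ0), normSign_mul_of_fixed hD hσeA (by rw [map_add, hσg, hσc]) heA0 hgc0]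
  -- the shell keeps the whole stratum (FILE 1), the stratum is the frame set (★ B7), decomposed into orbits (★ (C))
  rw [finsum_stratum_H_shell_eq_of_eq hD hE hmc hneq T ρ hρ h2ρmin, stratum_H_eq hvσ hfix hϖ T hρ, hmsv]
  obtain ⟨R, hRfin, hRcard, hR1, hR2, hR3⟩ := exists_fixed_class_representatives hσ hvσ hfix hϖ hd ρ 0 hρ
  simp only [Nat.mul_zero, pow_zero, Nat.add_zero] at hR1 hR2 hR3
  have hRadmfin : {g : K | g ∈ R ∧ Valued.v (1 + g) = 1}.Finite := hRfin.subset (Set.sep_subset _ _)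
  have hunion := coreHangingStratum_eq_iUnion_orbits hσ hvσ hϖ hTr T hT hα1 hβ1 h₁ h₂ h₃ hρ hρ₁ hρ₂ hρ₃ hR1 hR2
  have horb : ∀ g ∈ {g : K | g ∈ R ∧ Valued.v (1 + g) = 1}, ∀ M ∈ {M : Submodule 𝒪[K] (Fin 3 → K) | ∃ u ∈ unitTorus K 3,
        M = mapGL (diagGLUnits u) (latt (!![1, 0, 0; 1, ϖ ^ ρ, 0; 1 * 1 + g, ϖ ^ ρ * 1, ϖ ^ (2 * ρ)] : Matrix (Fin 3) (Fin 3) K))},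
      M ∈ normalisedStableLattices T ∧
        LatticeInLevel ϖ (d % 2) (Matrix.diagonal ![α - 1, β - 1, 0]) M ∧ ¬ LatticeInLevel ϖ (d % 2 + 1) (Matrix.diagonal ![α - 1, β - 1, 0]) M ∧
          LatticeInLevel ϖ (mcOfRecord d) (Matrix.diagonal ![(α - 1) * (α - 1), (β - 1) * (β - 1), 0]) M := by
    intro g hg M hM
    have hframe : M ∈ {M : Submodule 𝒪[K] (Fin 3 → K) | M ∈ normalisedStableLattices T ∧ IsDualisableLattice σ ϖ M ∧
        ∃ x ζ y'' : K, Valued.v x = 1 ∧ Valued.v ζ = 1 ∧ Valued.v y'' = 1 ∧ Valued.v (x * ζ + y'') = 1 ∧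
          M = latt (!![1, 0, 0; x, ϖ ^ ρ, 0; x * ζ + y'', ϖ ^ ρ * ζ, ϖ ^ (2 * ρ)] : Matrix (Fin 3) (Fin 3) K)} := by
      rw [hunion]; exact Set.mem_biUnion hg hM
    have hstr : M ∈ stratum σ ϖ T ![2 * ρ, 2 * ρ, 2 * ρ] := by rw [stratum_H_eq hvσ hfix hϖ T hρ]; exact hframe
    exact ⟨hframe.1, (shell_iff_of_mem_stratum_H hD hE hmc hneq T hρ M hstr).2 h2ρmin⟩
  rw [hunion, finsum_mem_biUnion (pairwise_disjoint_orbits hϖ ρ (fun g hg => (hR1 g hg).2) hR3) hRadmfin (fun g hg => finite_orbit hϖ hρ (hR1 _ hg.1).2),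
    finsum_mem_congr rfl (fun g hg => finsum_orbit_labelledOdd_div_relIndex_eq_of_near₃ hD h2 hρ (hR1 _ hg.1).1 (hR1 _ hg.1).2 hg.2 hE hℓN hmN hℓmc hmmc hT
      (horb g hg) hσgα hσgβ (hG g (hR1 _ hg.1).1 (hR1 _ hg.1).2 hg.2).1 (hG g (hR1 _ hg.1).1 (hR1 _ hg.1).2 hg.2).2.1 (hG g (hR1 _ hg.1).1 (hR1 _ hg.1).2 hg.2).2.2.1 hgα hgβ i)]
  -- the orbit mass (g-independent); `N·mass = q^{2ρ−1}`
  set mass : ℚ := ((((Nat.card 𝓀[K] - 1) * Nat.card 𝓀[K] ^ (ρ - 1)) * ((Nat.card 𝓀[K] - 1) * Nat.card 𝓀[K] ^ (2 * ρ - 1)) : ℕ) : ℚ) *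
    ((((Nat.card 𝓀[K] - 1) * Nat.card 𝓀[K] ^ ((ρ + 1) / 2 - 1)) * ((Nat.card 𝓀[K] - 1) * Nat.card 𝓀[K] ^ (ρ - 1)) : ℕ) : ℚ)⁻¹ with hmass
  have hNmass : ((Nat.card 𝓀[K] : ℚ) ^ ((ρ + 1) / 2 - 1)) * mass = (Nat.card 𝓀[K] : ℚ) ^ (2 * ρ - 1) := by
    rw [hmass]
    have hq1 : ((Nat.card 𝓀[K] : ℚ) - 1) ≠ 0 := by
      have : (1 : ℚ) < Nat.card 𝓀[K] := by exact_mod_cast hq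
      linarith
    have hq0 : (Nat.card 𝓀[K] : ℚ) ≠ 0 := by exact_mod_cast (by omega : Nat.card 𝓀[K] ≠ 0)
    push_cast [Nat.cast_sub hq.le]
    field_simp
  clear_value mass
  -- the admissible classes as a Finset system `S` (★ κH (B1a) letters)
  rw [finsum_mem_eq_finite_toFinset_sum _ hRadmfin]
  set S := hRadmfin.toFinset with hSdef
  have hmem : ∀ g, g ∈ S ↔ g ∈ R ∧ Valued.v (1 + g) = 1 := fun g => Set.Finite.mem_toFinset hRadmfin
  have hS1 : ∀ g ∈ S, σ g = g ∧ Valued.v g = 1 ∧ Valued.v (1 + g) = 1 := fun g hg =>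
    ⟨(hR1 g ((hmem g).1 hg).1).1, (hR1 g ((hmem g).1 hg).1).2, ((hmem g).1 hg).2⟩
  have hS2 : ∀ f : K, σ f = f → Valued.v f = 1 → Valued.v (1 + f) = 1 → ∃ g ∈ S, Valued.v (f - g) ≤ Valued.v ϖ ^ ρ := by
    intro f hσf hf h1f
    obtain ⟨g, hgR, hfg⟩ := hR2 f hσf hf
    refine ⟨g, (hmem g).2 ⟨hgR, ?_⟩, hfg⟩
    rw [show 1 + g = (1 + f) + -(f - g) by ring]
    exact v_add_eq_one_of_lt h1f (by rw [Valuation.map_neg]; exact hfg.trans_lt hpρ)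
  have hS3 : ∀ g ∈ S, ∀ g' ∈ S, Valued.v (g - g') ≤ Valued.v ϖ ^ ρ → g = g' :=
    fun g hg g' hg' h => hR3 g ((hmem g).1 hg).1 g' ((hmem g').1 hg').1 h
  have hε : ∀ g ∈ S, normSign σ (g * ((ϖ * σ ϖ) ^ ρ * eA) + (ϖ * σ ϖ) ^ ρ * eB) = normSign σ eA * normSign σ (g + eB / eA) := fun g hg =>
    (hG g (hS1 g hg).1 (hS1 g hg).2.1 (hS1 g hg).2.2).2.2.2
  have hsq1 : ∀ x : K, (normSign σ x : ℚ) * (normSign σ x : ℚ) = 1 := fun x => by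
    exact_mod_cast F0P3cDyRamDiagonalKappaSplitCountEval.normSign_mul_self σ x
  -- `ω(1 − δ) = ω(1 + δ) = ω(c) = ω(e_A)ω(e_B)` (`2δ ∈ 𝔭^{2d}`; `c = e_A e_B · N(e_A⁻¹)`)
  have hωpm : normSign σ (1 - (eB / eA - 1)) = normSign σ (1 + (eB / eA - 1)) := by
    refine normSign_eq_of_near hD (by rw [map_add, map_one, hσδ]) (by rw [map_sub, map_one, hσδ])
      (by rw [add_sub_cancel, map_div₀, heA1, heB1, div_one]) (n := 2 * d - 1) le_rfl ?_
    rw [show (1 : K) + (eB / eA - 1) - (1 - (eB / eA - 1)) = 2 * (eB / eA - 1) by ring, map_mul, hvδ]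
    have h2sq := v_le_varpi_sq_of_fixed_of_lt_one hD (map_ofNat σ 2) h2
    calc Valued.v (2 : K) * Valued.v ϖ ^ (2 * d - 2) ≤ Valued.v ϖ ^ 2 * Valued.v ϖ ^ (2 * d - 2) := mul_le_mul' h2sq le_rfl
      _ = Valued.v ϖ ^ (2 + (2 * d - 2)) := (pow_add _ _ _).symm
      _ ≤ Valued.v ϖ ^ (2 * d - 1) := pow_le_pow_right_of_le_one' hϖ1.le (by omega)
  have hωc : normSign σ (1 + (eB / eA - 1)) = normSign σ eA * normSign σ eB := by
    rw [add_sub_cancel, show eB / eA = eA * eB * (eA⁻¹ * σ eA⁻¹) by rw [map_inv₀, hσeA]; field_simp,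
      F0P3cDyRamFixedCountDiagonalModel.normSign_mul_norm σ _ (inv_ne_zero heA0), normSign_mul_of_fixed hD hσeA hσeB heA0 heB0]
  fin_cases i
  · -- slot 0: `ι·ω(e_A)·Σ_g ω(g)ω(g + c)·mass∕2 = 0` (FILE 4b)
    simp only [Fin.zero_eta]
    by_cases hal : 2 * d - 1 ≤ ρ
    · have hterm : ∀ g ∈ S, (((![normSign σ g * normSign σ (g * ((ϖ * σ ϖ) ^ ρ * eA) + (ϖ * σ ϖ) ^ ρ * eB) * (if 2 * d - 1 ≤ ρ then 1 else 0),
             normSign σ (g * ((ϖ * σ ϖ) ^ ρ * eA) + (ϖ * σ ϖ) ^ ρ * eB) * (if 2 * d - 1 ≤ ρ then 1 else 0),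
             normSign σ (-(1 + g)) * normSign σ (g * ((ϖ * σ ϖ) ^ ρ * eA) + (ϖ * σ ϖ) ^ ρ * eB)] : Fin 3 → ℤ) 0 : ℤ) : ℚ) / 2 * mass =
          ((normSign σ eA : ℤ) : ℚ) / 2 * mass * ((normSign σ g * normSign σ (g + eB / eA) : ℤ) : ℚ) := by
        intro g hg
        simp only [cons_val_zero, if_pos hal, mul_one, hε g hg]
        push_cast; ring
      rw [Finset.sum_congr rfl hterm, ← Finset.mul_sum, ← Int.cast_sum, sum_normSign_mul_normSign_add_eq_zero hD h2 hal hσc hc1 S hS1 hS2 hS3]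
      simp
    · have hterm : ∀ g ∈ S, (((![normSign σ g * normSign σ (g * ((ϖ * σ ϖ) ^ ρ * eA) + (ϖ * σ ϖ) ^ ρ * eB) * (if 2 * d - 1 ≤ ρ then 1 else 0),
             normSign σ (g * ((ϖ * σ ϖ) ^ ρ * eA) + (ϖ * σ ϖ) ^ ρ * eB) * (if 2 * d - 1 ≤ ρ then 1 else 0),
             normSign σ (-(1 + g)) * normSign σ (g * ((ϖ * σ ϖ) ^ ρ * eA) + (ϖ * σ ϖ) ^ ρ * eB)] : Fin 3 → ℤ) 0 : ℤ) : ℚ) / 2 * mass = 0 := by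
        intro g _
        simp only [cons_val_zero, if_neg hal, mul_zero, Int.cast_zero, zero_div, zero_mul]
      rw [Finset.sum_congr rfl hterm]
      simp
  · -- slot 1: `ι·ω(e_A)·Σ_g ω(g + c)·mass∕2 = 0` (FILE 4b)
    simp only [Fin.mk_one]
    by_cases hal : 2 * d - 1 ≤ ρ
    · have hterm : ∀ g ∈ S, (((![normSign σ g * normSign σ (g * ((ϖ * σ ϖ) ^ ρ * eA) + (ϖ * σ ϖ) ^ ρ * eB) * (if 2 * d - 1 ≤ ρ then 1 else 0),
             normSign σ (g * ((ϖ * σ ϖ) ^ ρ * eA) + (ϖ * σ ϖ) ^ ρ * eB) * (if 2 * d - 1 ≤ ρ then 1 else 0),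
             normSign σ (-(1 + g)) * normSign σ (g * ((ϖ * σ ϖ) ^ ρ * eA) + (ϖ * σ ϖ) ^ ρ * eB)] : Fin 3 → ℤ) 1 : ℤ) : ℚ) / 2 * mass =
          ((normSign σ eA : ℤ) : ℚ) / 2 * mass * ((normSign σ (g + eB / eA) : ℤ) : ℚ) := by
        intro g hg
        simp only [cons_val_one, cons_val_zero, if_pos hal, mul_one, hε g hg]
        push_cast; ring
      rw [Finset.sum_congr rfl hterm, ← Finset.mul_sum, ← Int.cast_sum, sum_normSign_add_eq_zero hD h2 hal hσc hc1 S hS1 hS2 hS3]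
      simp
    · have hterm : ∀ g ∈ S, (((![normSign σ g * normSign σ (g * ((ϖ * σ ϖ) ^ ρ * eA) + (ϖ * σ ϖ) ^ ρ * eB) * (if 2 * d - 1 ≤ ρ then 1 else 0),
             normSign σ (g * ((ϖ * σ ϖ) ^ ρ * eA) + (ϖ * σ ϖ) ^ ρ * eB) * (if 2 * d - 1 ≤ ρ then 1 else 0),
             normSign σ (-(1 + g)) * normSign σ (g * ((ϖ * σ ϖ) ^ ρ * eA) + (ϖ * σ ϖ) ^ ρ * eB)] : Fin 3 → ℤ) 1 : ℤ) : ℚ) / 2 * mass = 0 := by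
        intro g _
        simp only [cons_val_one, cons_val_zero, if_neg hal, mul_zero, Int.cast_zero, zero_div, zero_mul]
      rw [Finset.sum_congr rfl hterm]
      simp
  · -- slot 2: `ω(−1)ω(e_A)ω(1+δ)∕2·mass · Σ_g ψ(h(g))`, `h(g) = −g∕(1+g)`; the Möbius transport and FILE 4b′ §3
    simp only [Fin.reduceFinMk]
    -- `ω(1+g)·ω(g+c) = ω(1 + δ·1)·ω(1 + δ·h(g))`
    have hkey : ∀ g ∈ S, normSign σ (1 + g) * normSign σ (g + eB / eA) =
        normSign σ (1 + (eB / eA - 1)) * normSign σ (1 + (eB / eA - 1) * (-g / (1 + g))) := by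
      intro g hg
      obtain ⟨hσg, hvg, h1g⟩ := hS1 g hg
      have h1g0 : 1 + g ≠ 0 := fun h => by rw [h, map_zero] at h1g; exact zero_ne_one h1g
      obtain ⟨hgc, -⟩ := F0P3cDyRamAdmissibleShiftedCharacterSums.v_add_admissible h2 hvg h1g hc1
      have hgc0 : g + eB / eA ≠ 0 := fun h => by rw [h, map_zero] at hgc; exact zero_ne_one hgc
      have hσ1g : σ (1 + g) = 1 + g := by rw [map_add, map_one, hσg]
      obtain ⟨hvh, -⟩ := v_moebius hvg h1g
      have hσh : σ (-g / (1 + g)) = -g / (1 + g) := by rw [map_div₀, map_neg, hσ1g, hσg]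
      have hadd := normSign_one_add_mul_add hD h2 hσδ hvδ.le (map_one σ) hσh (le_of_eq (map_one _)) hvh.le
      rw [mul_one] at hadd
      rw [← normSign_mul_of_fixed hD hσ1g (by rw [map_add, hσg, hσc]) h1g0 hgc0, ← hadd,
        show (1 + g) * (g + eB / eA) = (1 + (eB / eA - 1) * (1 + -g / (1 + g))) * ((1 + g) * σ (1 + g)) by rw [hσ1g]; field_simp; ring,
        F0P3cDyRamFixedCountDiagonalModel.normSign_mul_norm σ _ h1g0]
    have hωneg : ∀ g ∈ S, normSign σ (-(1 + g)) = normSign σ (-1 : K) * normSign σ (1 + g) := fun g hg => by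
      have h1g0 : 1 + g ≠ 0 := fun h => by have := (hS1 g hg).2.2; rw [h, map_zero] at this; exact zero_ne_one this
      rw [← normSign_mul_of_fixed hD (by rw [map_neg, map_one]) (by rw [map_add, map_one, (hS1 g hg).1]) (neg_ne_zero.2 one_ne_zero) h1g0, neg_one_mul]
    have hterm : ∀ g ∈ S, (((![normSign σ g * normSign σ (g * ((ϖ * σ ϖ) ^ ρ * eA) + (ϖ * σ ϖ) ^ ρ * eB) * (if 2 * d - 1 ≤ ρ then 1 else 0),
             normSign σ (g * ((ϖ * σ ϖ) ^ ρ * eA) + (ϖ * σ ϖ) ^ ρ * eB) * (if 2 * d - 1 ≤ ρ then 1 else 0),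
             normSign σ (-(1 + g)) * normSign σ (g * ((ϖ * σ ϖ) ^ ρ * eA) + (ϖ * σ ϖ) ^ ρ * eB)] : Fin 3 → ℤ) 2 : ℤ) : ℚ) / 2 * mass =
        ((normSign σ (-1 : K) * normSign σ eA * normSign σ (1 + (eB / eA - 1)) : ℤ) : ℚ) / 2 * mass *
          ((normSign σ (1 + (eB / eA - 1) * (-g / (1 + g))) : ℤ) : ℚ) := by
      intro g hg
      simp only [cons_val_two, Nat.succ_eq_add_one, Nat.reduceAdd, tail_cons, head_cons, hωneg g hg, hε g hg]
      have hk' : (normSign σ (1 + g) : ℚ) * (normSign σ (g + eB / eA) : ℚ) =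
          (normSign σ (1 + (eB / eA - 1)) : ℚ) * (normSign σ (1 + (eB / eA - 1) * (-g / (1 + g))) : ℚ) := by exact_mod_cast hkey g hg
      push_cast
      linear_combination ((normSign σ (-1 : K) : ℚ) * (normSign σ eA : ℚ) / 2 * mass) * hk'
    rw [Finset.sum_congr rfl hterm, ← Finset.mul_sum]
    -- the Möbius transport `h = −g∕(1+g)` and FILE 4b′ §3
    obtain ⟨hM1, hM2, hM3⟩ := repr_admissible_image_moebius S hS1 hS2 hS3
    have hinj : Set.InjOn (fun g : K => -g / (1 + g)) ↑S := by
      intro g hg g' hg' h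
      have h1g0 : (1 : K) + g ≠ 0 := fun h0 => by have := (hS1 g hg).2.2; rw [h0, map_zero] at this; exact zero_ne_one this
      have h1g'0 : (1 : K) + g' ≠ 0 := fun h0 => by have := (hS1 g' hg').2.2; rw [h0, map_zero] at this; exact zero_ne_one this
      have h' := congrArg (fun x : K => -x / (1 + x)) h
      simp only at h'
      rwa [moebius_moebius h1g0, moebius_moebius h1g'0] at h'
    have hsi : ∑ h ∈ S.image (fun g => -g / (1 + g)), normSign σ (1 + (eB / eA - 1) * h) =
        ∑ g ∈ S, normSign σ (1 + (eB / eA - 1) * (-g / (1 + g))) := Finset.sum_image hinj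
    have hsumψ : ∑ g ∈ S, ((normSign σ (1 + (eB / eA - 1) * (-g / (1 + g))) : ℤ) : ℚ) =
        -((Nat.card 𝓀[K] : ℚ) ^ ((ρ + 1) / 2 - 1)) * (1 + normSign σ (1 - (eB / eA - 1))) := by
      rw [← Int.cast_sum, ← hsi, sum_normSign_one_add_mul_eq_of_repr_admissible hD h2 hρ hσδ hvδ _ hM1 hM2 hM3]
      push_cast; ring
    rw [hsumψ, hωpm, hωc]
    simp only [cons_val_two, Nat.succ_eq_add_one, Nat.reduceAdd, tail_cons, head_cons]
    have hA := hsq1 eA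
    have hB := hsq1 eB
    push_cast
    linear_combination (-((normSign σ (-1 : K) : ℚ) * ((normSign σ eA : ℚ) + (normSign σ eB : ℚ))) / 2) * hNmass +
      (-(normSign σ (-1 : K) : ℚ) * ((Nat.card 𝓀[K] : ℚ) ^ ((ρ + 1) / 2 - 1) * mass) / 2 * ((normSign σ eA : ℚ) + (normSign σ eB : ℚ))) * hA +
      (-(normSign σ (-1 : K) : ℚ) * ((Nat.card 𝓀[K] : ℚ) ^ ((ρ + 1) / 2 - 1) * mass) / 2 *
        ((normSign σ eA : ℚ) * (normSign σ eA : ℚ) * (normSign σ eA : ℚ))) * hB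

end Summit.HodgeConjecture.HodgeConjecture.Cruxes.H413.F0P3cDyRamLabelledOddCoreHangingBoundarySum

end
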